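import Summits.BirchSwinnertonDyer.BirchSwinnertonDyer.Theorems.ClassRecordThreeCornerAtThreeShimuraWalkPresentationTransfer
import Summits.BirchSwinnertonDyer.BirchSwinnertonDyer.Theorems.ClassRecordThreeCornerAtThreeShimuraWalkDefs
import Summits.BirchSwinnertonDyer.BirchSwinnertonDyer.Theorems.ClassRecordThreeEulerHalvesAtThreeKolyvaginFamilyLineDefs
import Summits.BirchSwinnertonDyer.BirchSwinnertonDyer.Theorems.ClassRecordThreeEulerHalvesAtThreeWalkCebotarev
import Summits.BirchSwinnertonDyer.Rank1Residual.X11b.KolyvaginTowerLiftConcrete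
import HarnessLib

/-!
# DICTIONARY between the port-target currency `ShimuraWalk.PDiv ∕ mdiv` (universal over presentations, Gross depth; p592703) and the
# generalised-datum currency `JET.KolyvaginFamilyData.PDiv ∕ divOrd` (ONE transversal presentation, Zhang index; tam3-p1 g12 p592585)
# — the END GLUE of the (DIV) port (cell `bsd-stepL`, seat `bsd-stepL-corner3-p2` g8 = WIDTH-LEVER lane B, owner of
# `Cruxes/CornerAtThreeW/Lines/inert.lean`; `--supports stmt-BirchSwinnertonDyer-21420 --as helper`)

WHY (plan g39 RULING 47 (4): the McCallum swap (P1, corner-p1 g15) and the Jetchev walk (P2, tam3-p1 g13, in-place generalised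
`…KolyvaginFamilyWalkOrderedBase`, p595546) are being ported ON THE DATUM `JET.KolyvaginFamilyData W K ι n` = (y, σ, S transversal, emb);
their outputs speak `KolyvaginFamilyData.PDiv d p M := ∃ Q, p^M • Q = d.derivedPoint` (`Σ_{s ∈ S} s D_σ y`, ONE presentation) over
ZHANG-admissible conductors. The r6∕r7 port targets `ShimuraWalk.{SwapSupply,LevelSupply}AtThree(B6)` of BOTH corner lines speak
`ShimuraWalk.PDiv hK ι W ys p k μ` (EVERY presentation `(σ′, H′ ≤ H_c, f′)`) and Gross depth (`frobDepth`, `Conductor`). THIS FILE is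
the two-way dictionary, so that the family-datum walk discharges the port targets at the END with no further carrier work:
* §1 `familyData_σ_pow_succ_eq_one` — `d.σ_q^{q+1} = 1` at a square-free level with inert prime factors (tree
  `RingClassTower.pow_succ_eq_one_of_mem_ringClassGalOver`); `exists_familyData_y_eq` — EVERY bare family `ys` populates the datum:
  `∃ d : KolyvaginFamilyData W K ι k, d.y = ys k` (x11b3-p8's anchor-free tower `RingClassTower.exists_coherent_towerData_derivedPoint`).
* §2 `pDiv_iff_familyData_pDiv` — for `d` with `d.y = ys k`, `k` square-free on Kolyvagin primes of Gross depth `M ≥ 1`, the weak (B4)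
  label at level `k`, and `μ ≤ M`: `ShimuraWalk.PDiv hK ι W ys p k μ ↔ d.PDiv p μ`. (→) instantiate `PDiv` at the datum's presentation
  pulled into `𝒢_k` (`σ₁ q := ⟨d.σ q, _⟩`, `H_c`, a section valued in `d.S`) and x11b3-p8's H37 bridge `kolyvaginPoint = derivedPoint`;
  (←) the «one ⟹ all» transfer `exists_smul_eq_kolyvaginPoint_of_presentation` (p596384) from that transversal presentation.
* §3 `natCast_le_mdiv_iff_natCast_le_divOrd` (`μ ≤ M`) and `min_mdiv_eq_min_divOrd` : `min M m′(k) = min M ord_p(P_k)` in `ℕ∞`.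
* §4 Gross ⟹ Zhang bookkeeping for conductors: `natCast_le_kolyvaginIndex_of_le_frobDepth`, `frobLevelIndex_le_levelIndex`,
  `zhangAdmissible_of_conductor` (a `ShimuraWalk.Conductor` of Gross depth `≥ k ≥ 1` is Zhang-admissible at index `k`; tam3-p1's
  `zhang_isKolyvaginPrime_of_frobEqFrobInfty`, McCallum 1991 §4 p. 300).
HONEST FRAMING: theorems only (no definition, no named fact, no `sorry`); bookkeeping between two tree currencies; nothing about any
curve's arithmetic; no stub closes; BSD is not proved by any of this; T7. Credit: tam3-p1 g12 (datum + line defs), x11b3-p8 (tower,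
H37 bridge), shim-p1 g8 (K4d). References: [cite: GrossLMS1991, §3 (3.2)–(3.3), Prop. 3.6, §4 (4.1)] [cite: McCallumLMS1991, §4 (4), p. 300,
§5 p. 303] [cite: WZhang2014, Notations (xii)] [cite: Jetchev2008, §3.1 items 2, 5].
presearch: not applicable (dictionary between two tree currencies); `lean search 'pDiv_iff_familyData|min_mdiv_eq'` → none.
-/

set_option autoImplicit false
set_option linter.dupNamespace false

noncomputable section

open scoped Classical

namespace Summit.BirchSwinnertonDyer.BirchSwinnertonDyer.Theorems.ShimuraWalk

open WeierstrassCurve Field NumberField IsDedekindDomain Finset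
  Literature.NumberTheory.EllipticCurves Literature.NumberTheory.GaloisRepresentations
  Literature.NumberTheory.EllipticCurves.KolyvaginCocycle
  Literature.NumberTheory.EllipticCurves.KolyvaginEuler
  Literature.NumberTheory.EllipticCurves.RingClassField
  Literature.NumberTheory.EllipticCurves.ModularForms
  Summit.BirchSwinnertonDyer.Rank1Residual.X11b
  Summit.BirchSwinnertonDyer.Rank1Residual.JET
  Summit.BirchSwinnertonDyer.BirchSwinnertonDyer.Theorems

variable {K : Type} [Field K] [NumberField K] {W : WeierstrassCurve ℚ} {ι : K →+* ℂ}

/-! ### §1 The datum: generator orders, and population from a bare family -/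

/-- `d.σ_q^{q+1} = 1` for a family datum at a square-free level whose prime factor `q` is inert in `K` (Gross 1991 §3: `G_q` cyclic of order
dividing `q + 1`; tree `RingClassTower.pow_succ_eq_one_of_mem_ringClassGalOver`). [cite: GrossLMS1991, §3 (G_ℓ cyclic of order ℓ + 1)] -/
theorem familyData_σ_pow_succ_eq_one (hK : IsImaginaryQuadratic K) {k : ℕ} (d : KolyvaginFamilyData W K ι k)
    (hk : Squarefree k) {q : ℕ} (hq : q ∈ k.primeFactors) (hinert : (Ideal.span {(q : 𝓞 K)}).IsPrime) :
    d.σ q ^ (q + 1) = 1 := by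
  obtain ⟨hqp, hqk, -⟩ := Nat.mem_primeFactors.mp hq
  have hqk' : ¬ q ∣ k / q := fun h ↦ by
    have : q * q ∣ k := by simpa [Nat.mul_div_cancel' hqk] using Nat.mul_dvd_mul_left q h
    exact hqp.one_lt.ne' (Nat.isUnit_iff.mp (hk q this))
  exact RingClassTower.pow_succ_eq_one_of_mem_ringClassGalOver hK ι hk.ne_zero hqp hqk hqk' hinert
    ((d.zpowers_σ q hq) ▸ Subgroup.mem_zpowers (d.σ q))

/-- **Every bare family populates the datum**: for a square-free `k` with inert prime factors and any `ys`, there is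
`d : KolyvaginFamilyData W K ι k` with `d.y = ys k` (generators, a transversal and an embedding from x11b3-p8's anchor-free coherent tower).
[cite: GrossLMS1991, §3 (σ_ℓ), §4 (4.1) (S)] -/
theorem exists_familyData_y_eq (hK : IsImaginaryQuadratic K) (ι : K →+* ℂ) {k : ℕ} (hk : Squarefree k)
    (hinert : ∀ q ∈ k.primeFactors, (Ideal.span {(q : 𝓞 K)}).IsPrime)
    (ys : (m : ℕ) → (W.baseChange (ringClassField K ι m)).toAffine.Point) :
    ∃ d : KolyvaginFamilyData W K ι k, d.y = ys k := by
  obtain ⟨res, g, T, emb, h1, h2, h3, h4, -⟩ :=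
    RingClassTower.exists_coherent_towerData_derivedPoint (W := W) hK ι hk hinert
  exact ⟨{ y := ys k
           σ := fun q ↦ res k (g q)
           zpowers_σ := fun q hq ↦ (h2 k dvd_rfl q hq).1
           S := T.image (fun t ↦ res k t)
           S_subset := fun s hs ↦ by
             obtain ⟨t, -, rfl⟩ := Finset.mem_image.mp hs
             exact RingClassTower.restrictHom_mem_ringClassGal ι (h1 k dvd_rfl) t
           S_transversal := h3 k dvd_rfl
           emb := emb k dvd_rfl
           emb_apply := h4 k dvd_rfl }, rfl⟩

/-! ### §2 `ShimuraWalk.PDiv ↔ KolyvaginFamilyData.PDiv` -/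

/-- **The dictionary `ShimuraWalk.PDiv hK ι W ys p k μ ↔ d.PDiv p μ`** (`μ ≤ M`) for a family datum `d` at the level `k` with
`d.y = ys k`, `k` square-free on Kolyvagin primes of Gross depth `M ≥ 1` (`IsKolyvaginPrime N W K p q ∧ FrobEqFrobInfty W K (p^M) q`),
and the weak (B4) label at `k` (`Σ_{i ≤ ℓ} σ^i ys_k = a_ℓ • y′` for every generator `σ` of `G(ℓ)`). (→): the datum's transversal
presentation, pulled into `𝒢_k = ringClassGal ι k`, instantiates `PDiv`; its Kolyvagin point IS `d.derivedPoint` (x11b3-p8's H37 bridge).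
(←): «one ⟹ all» (p596384). [cite: GrossLMS1991, Prop. 3.6, §4 (4.1)] [cite: McCallumLMS1991, §4 (4), §5 p. 303] -/
theorem pDiv_iff_familyData_pDiv (hK : IsImaginaryQuadratic K) (ι : K →+* ℂ) {N : ℕ} [NeZero N]
    [W.IsElliptic] [W.IsGloballyMinimal] (Dt : ModularParametrizationData W N) {p M : ℕ} (hp : p.Prime) (hM : 1 ≤ M)
    {k : ℕ} (hk : Squarefree k)
    (hkol : ∀ q ∈ k.primeFactors, IsKolyvaginPrime N W K p q ∧ FrobEqFrobInfty W K (p ^ M) q)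
    (ys : (m : ℕ) → (W.baseChange (ringClassField K ι m)).toAffine.Point)
    (d : KolyvaginFamilyData W K ι k) (hy : d.y = ys k)
    (hB4 : ∀ ℓ ∈ k.primeFactors, ∀ σ : ringClassField K ι k ≃ₐ[ℚ] ringClassField K ι k,
      Subgroup.zpowers σ = ringClassGalOver ι k (k / ℓ) →
      ∃ y' : (W.baseChange (ringClassField K ι k)).toAffine.Point,
        ∑ i ∈ Finset.range (ℓ + 1), pointGalHom W (ringClassField K ι k) (σ ^ i) (ys k) =
          W.frobeniusTrace ℓ • y')
    {μ : ℕ} (hμ : μ ≤ M) :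
    PDiv hK ι W ys p k μ ↔ d.PDiv p μ := by
  -- the structures of `PDiv`'s body
  letI hcg : CommGroup (ringClassGal ι k) := { (inferInstance : Group (ringClassGal ι k)) with
    mul_comm := fun a b ↦ (KolyvaginH44.isMulCommutative_ringClassGal' hK ι k).is_comm.comm a b }
  letI act : DistribMulAction (ringClassGal ι k) ((W.baseChange (ringClassField K ι k)).toAffine.Point) :=
    DistribMulAction.compHom _ ((pointGalHom W (ringClassField K ι k)).comp (ringClassGal ι k).subtype)
  haveI : Finite (ringClassGal ι k) := KolyvaginH44.finite_ringClassGal hK ι k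
  set ρ : ringClassGal ι k →* (ringClassField K ι k ≃ₐ[ℚ] ringClassField K ι k) := (ringClassGal ι k).subtype
    with hρ
  have hρi : Function.Injective ρ := (ringClassGal ι k).subtype_injective
  have hsmul : ∀ (g : ringClassGal ι k) (Q : (W.baseChange (ringClassField K ι k)).toAffine.Point),
      g • Q = pointGalHom W (ringClassField K ι k) (ρ g) Q := fun _ _ ↦ rfl
  -- the datum's presentation inside `𝒢_k`
  have hσmem : ∀ q ∈ k.primeFactors, d.σ q ∈ ringClassGal ι k := fun q hq ↦
    ringClassGalOver_le_ringClassGal ι k (k / q) ((d.zpowers_σ q hq) ▸ Subgroup.mem_zpowers (d.σ q))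
  let σ₁ : ℕ → ringClassGal ι k := fun q ↦ if hq : q ∈ k.primeFactors then ⟨d.σ q, hσmem q hq⟩ else 1
  have hσ₁ : ∀ q ∈ k.primeFactors, ρ (σ₁ q) = d.σ q := fun q hq ↦ by
    simp only [σ₁, dif_pos hq]; rfl
  have hinert : ∀ q ∈ k.primeFactors, (Ideal.span {(q : 𝓞 K)}).IsPrime := fun q hq ↦ (hkol q hq).1.2.2.2.2.1
  have hord₁ : ∀ q ∈ k.primeFactors, σ₁ q ^ (q + 1) = 1 := fun q hq ↦ hρi (by
    rw [map_pow, hσ₁ q hq, map_one]; exact familyData_σ_pow_succ_eq_one hK d hk hq (hinert q hq))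
  have hz₁ : ∀ q ∈ k.primeFactors, (Subgroup.zpowers (σ₁ q)).map ρ = ringClassGalOver ι k (k / q) := fun q hq ↦ by
    rw [MonoidHom.map_zpowers, hσ₁ q hq]; exact d.zpowers_σ q hq
  -- the canonical subgroup and a section valued in `d.S`
  set Hc : Subgroup (ringClassGal ι k) := (ringClassGalOver ι k 1).comap ρ with hHc
  letI : Fintype (ringClassGal ι k ⧸ Hc) := Fintype.ofFinite _
  have hHc' : ∀ h ∈ Hc, ρ h ∈ ringClassGalOver ι k 1 := fun h hh ↦ Subgroup.mem_comap.mp hh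
  have hSρ : ((d.S : Set (ringClassField K ι k ≃ₐ[ℚ] ringClassField K ι k))) ⊆ Set.range ρ :=
    fun s hs ↦ ⟨⟨s, d.S_subset s hs⟩, rfl⟩
  obtain ⟨g, hg, hgS⟩ := exists_section_comap_of_transversal ι k ρ (fun g ↦ g.2) hSρ d.S_transversal
  -- H37 bridge: the Kolyvagin point of `(σ₁, H_c, g)` is the datum's derived point
  have hbij := KolyvaginH37Bridge.bijOn_of_section_of_transversal ρ hρi (H := Hc)
    (Γ := ringClassGal ι k) (G₁ := ringClassGalOver ι k 1) hHc'
    (S := (↑d.S : Set (ringClassField K ι k ≃ₐ[ℚ] ringClassField K ι k)))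
    (fun s hs ↦ d.S_subset s hs) hSρ (fun g hg ↦ d.S_transversal g hg) g hg hgS
  have hbr : kolyvaginPoint σ₁ k.primeFactors g (ys k) = d.derivedPoint := by
    have h := KolyvaginH37Bridge.map_kolyvaginPoint_eq_derivedPoint (pointGalHom W (ringClassField K ι k))
      ρ (AddMonoidHom.id ((W.baseChange (ringClassField K ι k)).toAffine.Point)) (fun g a ↦ hsmul g a) hk
      (τ := d.σ) hσ₁ g hbij (ys k)
    rw [AddMonoidHom.id_apply, AddMonoidHom.id_apply] at h
    rw [h, ← hy]
    rfl
  constructor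
  · -- (→): instantiate at the datum's presentation
    intro hPD
    obtain ⟨B, hB⟩ := hPD σ₁ Hc g hord₁ (fun q hq ↦ by rw [← hz₁ q hq, MonoidHom.map_zpowers]; rfl) hg hHc'
    exact ⟨B, hB.trans hbr⟩
  · -- (←): «one ⟹ all»
    rintro ⟨Q, hQ⟩
    intro σ' H' _ f' h1 h2 h3 h4
    exact exists_smul_eq_kolyvaginPoint_of_presentation hK ι Dt hp hM hk hkol ρ hρi (fun g ↦ g.2) (AddEquiv.refl _)
      (fun g a ↦ hsmul g a) (ys k) hB4 σ₁ Hc g d.S hHc' hg hgS d.S_subset hSρ d.S_transversal hz₁ hord₁ σ' H' f' h4 h3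
      (fun q hq ↦ by rw [MonoidHom.map_zpowers]; exact h2 q hq) h1 hμ ⟨Q, hQ.trans hbr.symm⟩

/-! ### §3 `mdiv` versus `divOrd` -/

/-- `μ ≤ m′(k) ↔ μ ≤ ord_p(P_k)` for `μ ≤ M` (the dictionary of §2 read through `natCast_le_mdiv_iff` and tam3-p1's
`pDiv_of_le_divOrd` ∕ `natCast_le_divOrd_of_pDiv`). [cite: McCallumLMS1991, §5 p. 303] [cite: Jetchev2008, §3.1 item 5] -/
theorem natCast_le_mdiv_iff_natCast_le_divOrd (hK : IsImaginaryQuadratic K) (ι : K →+* ℂ) {N : ℕ} [NeZero N]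
    [W.IsElliptic] [W.IsGloballyMinimal] (Dt : ModularParametrizationData W N) {p M : ℕ} (hp : p.Prime) (hM : 1 ≤ M)
    {k : ℕ} (hk : Squarefree k)
    (hkol : ∀ q ∈ k.primeFactors, IsKolyvaginPrime N W K p q ∧ FrobEqFrobInfty W K (p ^ M) q)
    (ys : (m : ℕ) → (W.baseChange (ringClassField K ι m)).toAffine.Point)
    (d : KolyvaginFamilyData W K ι k) (hy : d.y = ys k)
    (hB4 : ∀ ℓ ∈ k.primeFactors, ∀ σ : ringClassField K ι k ≃ₐ[ℚ] ringClassField K ι k,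
      Subgroup.zpowers σ = ringClassGalOver ι k (k / ℓ) →
      ∃ y' : (W.baseChange (ringClassField K ι k)).toAffine.Point,
        ∑ i ∈ Finset.range (ℓ + 1), pointGalHom W (ringClassField K ι k) (σ ^ i) (ys k) =
          W.frobeniusTrace ℓ • y')
    {μ : ℕ} (hμ : μ ≤ M) :
    (μ : ℕ∞) ≤ mdiv hK ι W ys p k ↔ (μ : ℕ∞) ≤ d.divOrd p := by
  rw [natCast_le_mdiv_iff, pDiv_iff_familyData_pDiv hK ι Dt hp hM hk hkol ys d hy hB4 hμ]
  exact ⟨fun h ↦ d.natCast_le_divOrd_of_pDiv p h, fun h ↦ d.pDiv_of_le_divOrd p μ h⟩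

/-- **`min M m′(k) = min M ord_p(P_k)` in `ℕ∞`**: below the Gross depth `M` of the level the two divisibility exponents agree.
[cite: McCallumLMS1991, §5 p. 303] [cite: Jetchev2008, §3.1 item 5] -/
theorem min_mdiv_eq_min_divOrd (hK : IsImaginaryQuadratic K) (ι : K →+* ℂ) {N : ℕ} [NeZero N]
    [W.IsElliptic] [W.IsGloballyMinimal] (Dt : ModularParametrizationData W N) {p M : ℕ} (hp : p.Prime) (hM : 1 ≤ M)
    {k : ℕ} (hk : Squarefree k)
    (hkol : ∀ q ∈ k.primeFactors, IsKolyvaginPrime N W K p q ∧ FrobEqFrobInfty W K (p ^ M) q)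
    (ys : (m : ℕ) → (W.baseChange (ringClassField K ι m)).toAffine.Point)
    (d : KolyvaginFamilyData W K ι k) (hy : d.y = ys k)
    (hB4 : ∀ ℓ ∈ k.primeFactors, ∀ σ : ringClassField K ι k ≃ₐ[ℚ] ringClassField K ι k,
      Subgroup.zpowers σ = ringClassGalOver ι k (k / ℓ) →
      ∃ y' : (W.baseChange (ringClassField K ι k)).toAffine.Point,
        ∑ i ∈ Finset.range (ℓ + 1), pointGalHom W (ringClassField K ι k) (σ ^ i) (ys k) =
          W.frobeniusTrace ℓ • y') :
    min (M : ℕ∞) (mdiv hK ι W ys p k) = min (M : ℕ∞) (d.divOrd p) := by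
  have key : ∀ μ : ℕ, μ ≤ M → ((μ : ℕ∞) ≤ mdiv hK ι W ys p k ↔ (μ : ℕ∞) ≤ d.divOrd p) :=
    fun μ hμ ↦ natCast_le_mdiv_iff_natCast_le_divOrd hK ι Dt hp hM hk hkol ys d hy hB4 hμ
  -- two elements of `ℕ∞` with the same naturals `≤ M` below them have the same `min M`
  have aux : ∀ x y : ℕ∞, (∀ μ : ℕ, μ ≤ M → (μ : ℕ∞) ≤ x → (μ : ℕ∞) ≤ y) → min (M : ℕ∞) x ≤ min (M : ℕ∞) y := by
    intro x y hxy
    have hne : min (M : ℕ∞) x ≠ ⊤ := ne_top_of_le_ne_top (ENat.coe_ne_top M) (min_le_left _ _)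
    set n : ℕ := (min (M : ℕ∞) x).toNat with hn
    have hmn : min (M : ℕ∞) x = (n : ℕ∞) := (ENat.coe_toNat hne).symm
    have hnM : n ≤ M := by exact_mod_cast (hmn ▸ min_le_left (M : ℕ∞) x : (n : ℕ∞) ≤ M)
    have hnx : (n : ℕ∞) ≤ x := hmn ▸ min_le_right _ _
    rw [hmn]
    exact le_min (by exact_mod_cast hnM) (hxy n hnM hnx)
  exact le_antisymm (aux _ _ fun μ hμ h ↦ (key μ hμ).mp h) (aux _ _ fun μ hμ h ↦ (key μ hμ).mpr h)

/-! ### §4 Gross conductors are Zhang-admissible -/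

/-- `j ≤ depth_Gross(q) ⟹ j ≤ M(q)` (Zhang's numeric index) for a Kolyvagin prime `q ∤ N_E` of `K` (McCallum 1991 §4 p. 300: Frobenius
conjugacy on `E[p^j]` gives `p^j ∣ q + 1`, `p^j ∣ a_q`; tree `Koly.zhang_isKolyvaginPrime_of_frobEqFrobInfty`).
[cite: McCallumLMS1991, §4 (pp. 299–300)] [cite: WZhang2014, Notations (xii)] -/
theorem natCast_le_kolyvaginIndex_of_le_frobDepth [W.IsElliptic] [W.IsGloballyMinimal] {p q j : ℕ} (hp : p.Prime)
    (hq : IsKolyvaginPrime (W.conductorNorm ℤ) W K p q) (hj : (j : ℕ∞) ≤ frobDepth W K p q) :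
    j ≤ Zhang2014.kolyvaginIndex W p q := by
  rcases Nat.eq_zero_or_pos j with rfl | hjpos
  · exact Nat.zero_le _
  · exact (Summit.BirchSwinnertonDyer.Rank1Residual.X11b.Three.Koly.zhang_isKolyvaginPrime_of_frobEqFrobInfty (W := W) (K := K) hp hjpos hq
      ((natCast_le_frobDepth_iff hq.2.2.2.2.2 j).mp hj)).2

/-- **A Gross conductor of depth `≥ k` is Zhang-admissible at index `k`** (`k ≥ 1`): square-free, every prime factor a Zhang–Kolyvagin prime
with `k ≤ M(q)` (tam3-p1's `zhang_isKolyvaginPrime_of_frobEqFrobInfty`). The family-datum walk (Zhang currency) therefore covers every conductor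
the port targets quantify over. [cite: GrossLMS1991, §3 (3.2)–(3.3)] [cite: WZhang2014, Notations (xii)] -/
theorem zhangAdmissible_of_conductor [W.IsElliptic] [W.IsGloballyMinimal] [NeZero (W.conductorNorm ℤ)] {p k : ℕ} (hp : p.Prime)
    (hk : 1 ≤ k) (c : Conductor W K (W.conductorNorm ℤ) p) (hc : (k : ℕ∞) ≤ frobLevelIndex W K p c.1) :
    Squarefree c.1 ∧ ∀ q ∈ c.1.primeFactors,
      Zhang2014.IsKolyvaginPrime (W.conductorNorm ℤ) W K p q ∧ k ≤ Zhang2014.kolyvaginIndex W p q := by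
  refine ⟨c.2.1, fun q hq ↦ ?_⟩
  have hfrob : FrobEqFrobInfty W K (p ^ k) q := (natCast_le_frobLevelIndex_iff c.2.2 k).mp hc q hq
  exact Summit.BirchSwinnertonDyer.Rank1Residual.X11b.Three.Koly.zhang_isKolyvaginPrime_of_frobEqFrobInfty (W := W) (K := K) hp hk (c.2.2 q hq) hfrob

/-- `M_Gross(c) ≤ M_Zhang(c)` for a Gross conductor: the Gross level index is below W. Zhang's numeric one.
[cite: McCallumLMS1991, §4 (p. 300)] [cite: WZhang2014, Notations (xii)] -/
theorem frobLevelIndex_le_levelIndex [W.IsElliptic] [W.IsGloballyMinimal] {p : ℕ} (hp : p.Prime)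
    (c : Conductor W K (W.conductorNorm ℤ) p) :
    frobLevelIndex W K p c.1 ≤ Zhang2014.levelIndex W p c.1 := by
  simp only [frobLevelIndex, Zhang2014.levelIndex, Finset.le_inf_iff]
  intro q hq
  refine le_trans (Finset.inf_le hq) ?_
  have hle : ∀ j : ℕ, (j : ℕ∞) ≤ frobDepth W K p q → (j : ℕ∞) ≤ (Zhang2014.kolyvaginIndex W p q : ℕ∞) :=
    fun j hj ↦ by exact_mod_cast natCast_le_kolyvaginIndex_of_le_frobDepth hp (c.2.2 q hq) hj
  by_cases htop : frobDepth W K p q = ⊤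
  · -- depth `⊤` would put every natural below the finite index
    exfalso
    have h := hle (Zhang2014.kolyvaginIndex W p q + 1) (by rw [htop]; exact le_top)
    have h' : Zhang2014.kolyvaginIndex W p q + 1 ≤ Zhang2014.kolyvaginIndex W p q := by exact_mod_cast h
    omega
  · rw [← ENat.coe_toNat htop]
    exact hle _ (ENat.coe_toNat htop).le

end Summit.BirchSwinnertonDyer.BirchSwinnertonDyer.Theorems.ShimuraWalk

end
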